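import Mathlib
import Summits.AtomisticToContinuum.Crystallization.Theses.PhononSlackCertificates

/-!
# Route `PhononSlackCertificates`, crux `NearFieldConvexity` (stmt-AtomisticToContinuum-13958), line `Sketch`:
stub `stub_pnfOfLocalCertificate` — the pure near-field inequality from a LOCAL CERTIFICATE

Skeleton v9 of the line reduces PNF (pure near-field convexity of finite good clusters,
`c·#NL(Ω) − C·#∂₄Ω ≤ Σ_{i∈Ω} ½Σ_{j∈Ω∖i} V_LJ − #Ω·e*`) to a POINTWISE calibrated inequality at
the radius-4 interior sites of `Ω`, with an antisymmetric transfer `τ` inside `Ω` under the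
summable envelope `|τ i j| ≤ M·|x i − x j|⁻⁶`.  This file is the bookkeeping: summing over the
interior `I`, internal transfers cancel by antisymmetry, the flux into the collar `B = Ω ∖ I = ∂₄Ω`
is `≤ 250·|M|·δ⁻⁶·#B` by the flux envelope (`stub_fluxEnvelope`, landed), collar sites are floored
by `−(250/12)δ⁻⁶` (`stub_selfSiteFloor`, landed), and `#NL(Ω) ≤ #NL(I) + #B`.
-/

noncomputable section

open scoped BigOperators
open Literature.MathematicalPhysics.StatisticalMechanics Literature.Geometry.DiscreteGeometry

namespace Summit.AtomisticToContinuum.Crystallization.Theorems.PhononSlackNearFieldConvexity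

/-- Counting: the subtype `{i // i ∈ Ω ∧ p i}` has `#(Ω.filter p)` elements. [folklore] -/
theorem lc_natCard_eq {ι : Type*} (Ω : Finset ι) (p : ι → Prop) [DecidablePred p] :
    Nat.card {i // i ∈ Ω ∧ p i} = (Ω.filter p).card := by
  have e : {i // i ∈ Ω ∧ p i} ≃ {i // i ∈ Ω.filter p} :=
    Equiv.subtypeEquivRight fun i => Finset.mem_filter.symm
  rw [Nat.card_congr e, Nat.card_eq_finsetCard]

/-- **Abstract bookkeeping for a local certificate.**  On a finite index type: a region `Ω`, its
interior `I ⊆ Ω`, the collar `B = Ω ∖ I`; an antisymmetric transfer `τ` and site excesses `E` with the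
calibrated pointwise bound on `I` (`0 ≤ E i + Σ_{j∈Ω} τ i j`, and `c ≤ …` at the sites where `NL`
holds), a bound `Φ` on the flux `Σ_{i∈I} Σ_{j∈B} τ i j` into the collar, and the floor `−L ≤ E` on the
collar; then `c·#(Ω ∩ NL) − (c + L)·#B − Φ ≤ Σ_Ω E` (internal transfers cancel by antisymmetry).
[folklore] -/
theorem lc_bookkeeping {ι : Type*} (NL : ι → Prop) [DecidablePred NL]
    (E : ι → ℝ) (τ : ι → ι → ℝ) (Ω I B : Finset ι) {c Φ L : ℝ} (hc : 0 < c)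
    (hτ : ∀ i j, τ i j = -τ j i) (hI : I ⊆ Ω) (hB : ∀ i, i ∈ B ↔ i ∈ Ω ∧ i ∉ I)
    (hpt : ∀ i ∈ I, 0 ≤ E i + (∑ j ∈ Ω, τ i j) ∧ (NL i → c ≤ E i + (∑ j ∈ Ω, τ i j)))
    (hflux : ∑ i ∈ I, ∑ j ∈ B, τ i j ≤ Φ)
    (hbdry : ∀ i ∈ B, -L ≤ E i) :
    c * ((Ω.filter NL).card : ℝ) - (c + L) * (B.card : ℝ) - Φ ≤ ∑ i ∈ Ω, E i := by
  classical
  -- split the region into interior and collar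
  have hΩsplit : ∀ f : ι → ℝ, ∑ i ∈ Ω, f i = ∑ i ∈ I, f i + ∑ i ∈ B, f i := by
    intro f
    rw [← Finset.sum_filter_add_sum_filter_not Ω (fun i => i ∈ I)]
    congr 1
    · congr 1
      ext i
      simp only [Finset.mem_filter]
      exact ⟨fun h => h.2, fun h => ⟨hI h, h⟩⟩
    · congr 1
      ext i
      rw [Finset.mem_filter, hB]
  -- interior: the calibrated pointwise bound, summed
  have hint : ∑ i ∈ I, (if NL i then c else 0) ≤ ∑ i ∈ I, (E i + ∑ j ∈ Ω, τ i j) := by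
    refine Finset.sum_le_sum fun i hi => ?_
    obtain ⟨h0, h1⟩ := hpt i hi
    split_ifs with h
    · exact h1 h
    · exact h0
  have hind : ∑ i ∈ I, (if NL i then c else 0) = c * ((I.filter NL).card : ℝ) := by
    rw [Finset.sum_ite, Finset.sum_const_zero, add_zero, Finset.sum_const, nsmul_eq_mul, mul_comm]
  -- internal transfers cancel
  have hanti : ∑ i ∈ I, ∑ j ∈ I, τ i j = 0 := by
    have h := Finset.sum_comm (s := I) (t := I) (f := τ)
    have h2 : ∑ j ∈ I, ∑ i ∈ I, τ i j = -∑ j ∈ I, ∑ i ∈ I, τ j i := by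
      rw [← Finset.sum_neg_distrib]
      refine Finset.sum_congr rfl fun j _ => ?_
      rw [← Finset.sum_neg_distrib]
      exact Finset.sum_congr rfl fun i _ => hτ i j
    linarith
  -- the transfer sum over `Ω` splits into the internal part and the flux into the collar
  have hτsplit : ∑ i ∈ I, ∑ j ∈ Ω, τ i j = ∑ i ∈ I, ∑ j ∈ I, τ i j + ∑ i ∈ I, ∑ j ∈ B, τ i j := by
    rw [← Finset.sum_add_distrib]
    exact Finset.sum_congr rfl fun i _ => hΩsplit (τ i)
  have hIsum : c * ((I.filter NL).card : ℝ) - Φ ≤ ∑ i ∈ I, E i := by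
    have h1 : ∑ i ∈ I, (E i + ∑ j ∈ Ω, τ i j) = ∑ i ∈ I, E i + ∑ i ∈ I, ∑ j ∈ Ω, τ i j :=
      Finset.sum_add_distrib
    rw [hind, h1, hτsplit, hanti, zero_add] at hint
    linarith
  -- collar: the floor
  have hBsum : -L * (B.card : ℝ) ≤ ∑ i ∈ B, E i := by
    have h : ∑ _i ∈ B, (-L) ≤ ∑ i ∈ B, E i := Finset.sum_le_sum fun i hi => hbdry i hi
    rwa [Finset.sum_const, nsmul_eq_mul, mul_comm] at h
  -- counting the non-layered sites
  have hcount : ((Ω.filter NL).card : ℝ) ≤ ((I.filter NL).card : ℝ) + (B.card : ℝ) := by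
    have h : Ω.filter NL ⊆ I.filter NL ∪ B := by
      intro i hi
      rw [Finset.mem_filter] at hi
      rw [Finset.mem_union, Finset.mem_filter, hB]
      by_cases hiI : i ∈ I
      · exact Or.inl ⟨hiI, hi.2⟩
      · exact Or.inr ⟨hi.1, hiI⟩
    exact_mod_cast (Finset.card_le_card h).trans (Finset.card_union_le _ _)
  have hmono := mul_le_mul_of_nonneg_left hcount hc.le
  rw [hΩsplit E]
  nlinarith [hmono, hIsum, hBsum]

/-- **Stub (bookkeeping, lead): PNF from the local certificate.**  Sum the pointwise inequality over
the radius-4 interior `I` of `Ω`: internal transfers cancel by antisymmetry, the flux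
`Σ_{i∈I}Σ_{j∈Ω∖I} τ i j` is `≤ 250·|M|·δ⁻⁶·#∂₄Ω` by the flux envelope, collar sites are floored by
the self-site floor, and `#NL(Ω) ≤ #NL(I) + #∂₄Ω`.  Constants: `c := c`,
`C := c + (250/12)δ⁻⁶ + 250·|M|·δ⁻⁶`. -/
theorem stub_pnfOfLocalCertificate
    (hfloor : ∀ (N : ℕ) (x : Fin N → EuclideanSpace ℝ (Fin 3)) (δ : ℝ), 0 < δ →
            (∀ i j : Fin N, i ≠ j → δ ≤ dist (x i) (x j)) →
            ∀ (Ω : Finset (Fin N)) (i : Fin N),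
              -(250 / 12 * δ⁻¹ ^ 6) ≤ (1 / 2 : ℝ) * (∑ j ∈ Ω.erase i, lennardJones (dist (x i) (x j))) -
                (⨅ Q : PeriodicConfiguration 3, Q.energyPerParticle lennardJones))
    (hflux : ∀ (N : ℕ) (x : Fin N → EuclideanSpace ℝ (Fin 3)) (δ : ℝ), 0 < δ →
            (∀ i j : Fin N, i ≠ j → δ ≤ dist (x i) (x j)) →
            ∀ (A B : Finset (Fin N)), Disjoint A B →
              ∑ i ∈ A, ∑ j ∈ B, (dist (x i) (x j))⁻¹ ^ 6 ≤ 250 * δ⁻¹ ^ 6 * (B.card : ℝ))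
    (hLC : ∀ δ : ℝ, 0 < δ → ∀ η : ℝ, 0 < η → ∃ c : ℝ, 0 < c ∧ ∃ M : ℝ, ∀ (N : ℕ) (x : Fin N → EuclideanSpace ℝ (Fin 3)),
            (∀ i j : Fin N, i ≠ j → δ ≤ dist (x i) (x j)) →
            ∀ Ω : Finset (Fin N), (∀ i ∈ Ω, IsTwoShellGood (1 / 20) (47 / 50) 1 x i) →
              ∃ τ : Fin N → Fin N → ℝ, (∀ i j, τ i j = -τ j i) ∧ (∀ i j, |τ i j| ≤ M * (dist (x i) (x j))⁻¹ ^ 6) ∧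
                ∀ i ∈ Ω, (∀ k : Fin N, dist (x k) (x i) ≤ 4 → k ∈ Ω) →
                  0 ≤ ((1 / 2 : ℝ) * (∑ j ∈ Ω.erase i, lennardJones (dist (x i) (x j))) - (⨅ Q : PeriodicConfiguration 3, Q.energyPerParticle lennardJones)) + ∑ j ∈ Ω, τ i j ∧
                  (¬ (∃ (A : EuclideanSpace ℝ (Fin 3) →ₗᵢ[ℝ] EuclideanSpace ℝ (Fin 3)) (t : EuclideanSpace ℝ (Fin 3)) (a : ℝ) (s : ℤ → ℤ) (z : ℤ → ℝ), 47 / 50 ≤ a ∧ a ≤ 1 ∧ IsHaggSeq s ∧ (∀ m : ℤ, 39 / 50 * a ≤ z (m + 1) - z m ∧ z (m + 1) - z m ≤ 17 / 20 * a) ∧ (fun S : Set (EuclideanSpace ℝ (Fin 3)) => (∀ j : Fin N, dist (x j) (x i) ≤ 2 → ∃ p ∈ S, dist (x j + t) p ≤ η) ∧ (∀ p ∈ S, dist p (x i + t) ≤ 2 → ∃ j : Fin N, dist (x j + t) p ≤ η)) {p | ∃ m i j : ℤ, p = A (((i : ℝ) • triangularVec₁ a) + ((j : ℝ) • triangularVec₂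 a) + ((haggLabel s m : ℝ) • barlowOffset a) + (z m • layerNormal 1))}) →
                    c ≤ ((1 / 2 : ℝ) * (∑ j ∈ Ω.erase i, lennardJones (dist (x i) (x j))) - (⨅ Q : PeriodicConfiguration 3, Q.energyPerParticle lennardJones)) + ∑ j ∈ Ω, τ i j)) :
    ∀ δ : ℝ, 0 < δ → ∀ η : ℝ, 0 < η → ∃ c : ℝ, 0 < c ∧ ∃ C : ℝ, ∀ (N : ℕ) (x : Fin N → EuclideanSpace ℝ (Fin 3)), (∀ i j : Fin N, i ≠ j → δ ≤ dist (x i) (x j)) → ∀ Ω : Finset (Fin N), (∀ i ∈ Ω, IsTwoShellGood (1 / 20) (47 / 50) 1 x i) → c * (Nat.card {i : Fin N // i ∈ Ω ∧ ¬ (∃ (A : EuclideanSpace ℝ (Fin 3) →ₗᵢ[ℝ] EuclideanSpace ℝ (Fin 3)) (t : EuclideanSpace ℝ (Fin 3)) (a : ℝ) (s : ℤ → ℤ) (z : ℤ → ℝ), 47 / 50 ≤ a ∧ a ≤ 1 ∧ IsHaggSeq s ∧ (∀ m : ℤ, 39 / 50 * a ≤ z (m + 1) - z m ∧ z (m + 1)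 - z m ≤ 17 / 20 * a) ∧ (fun S : Set (EuclideanSpace ℝ (Fin 3)) => (∀ j : Fin N, dist (x j) (x i) ≤ 2 → ∃ p ∈ S, dist (x j + t) p ≤ η) ∧ (∀ p ∈ S, dist p (x i + t) ≤ 2 → ∃ j : Fin N, dist (x j + t) p ≤ η)) {p | ∃ m i j : ℤ, p = A (((i : ℝ) • triangularVec₁ a) + ((j : ℝ) • triangularVec₂ a) + ((haggLabel s m : ℝ) • barlowOffset a) + (z m • layerNormal 1))})} : ℝ) - C * (Nat.card {i : Fin N // i ∈ Ω ∧ ∃ j : Fin N, j ∉ Ω ∧ dist (x j) (x i) ≤ 4} : ℝ) ≤ (∑ i ∈ Ω, (1 / 2 : ℝ) * (∑ j ∈ Ω.erase i, lennardJones (dist (x i) (x j)))) - (Ω.card : ℝ) * (⨅ Q : PeriodicConfiguration 3, Q.energyPerParticle lennardJones) := by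
  intro δ hδ η hη
  obtain ⟨c, hc, M, hM⟩ := hLC δ hδ η hη
  refine ⟨c, hc, c + 250 / 12 * δ⁻¹ ^ 6 + 250 * |M| * δ⁻¹ ^ 6, ?_⟩
  intro N x hsep Ω hΩ
  obtain ⟨τ, hτ, hτM, hpt⟩ := hM N x hsep Ω hΩ
  classical
  -- interior and collar of `Ω`
  set I : Finset (Fin N) := Ω.filter (fun i => ∀ k : Fin N, dist (x k) (x i) ≤ 4 → k ∈ Ω) with hIdef
  set B : Finset (Fin N) := Ω.filter (fun i => ∃ j : Fin N, j ∉ Ω ∧ dist (x j) (x i) ≤ 4) with hBdef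
  rw [lc_natCard_eq, lc_natCard_eq]
  have hIΩ : I ⊆ Ω := Finset.filter_subset _ _
  have hBmem : ∀ i, i ∈ B ↔ i ∈ Ω ∧ i ∉ I := by
    intro i
    simp only [hBdef, hIdef, Finset.mem_filter]
    constructor
    · rintro ⟨hi, j, hj, hd⟩
      exact ⟨hi, fun h' => hj (h'.2 j hd)⟩
    · rintro ⟨hi, h'⟩
      refine ⟨hi, ?_⟩
      by_contra hne
      exact h' ⟨hi, fun j hd => by_contra fun hj => hne ⟨j, hj, hd⟩⟩
  have hdisj : Disjoint I B := by
    rw [Finset.disjoint_left]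
    intro i hiI hiB
    exact ((hBmem i).1 hiB).2 hiI
  -- the flux into the collar, by the envelope
  have hfluxIB : ∑ i ∈ I, ∑ j ∈ B, τ i j ≤ 250 * |M| * δ⁻¹ ^ 6 * (B.card : ℝ) := by
    have h1 : ∑ i ∈ I, ∑ j ∈ B, τ i j ≤ ∑ i ∈ I, ∑ j ∈ B, |M| * (dist (x i) (x j))⁻¹ ^ 6 := by
      refine Finset.sum_le_sum fun i _ => Finset.sum_le_sum fun j _ => ?_
      have hb := hτM i j
      have h0 : (0 : ℝ) ≤ (dist (x i) (x j))⁻¹ ^ 6 := by positivity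
      calc τ i j ≤ |τ i j| := le_abs_self _
        _ ≤ M * (dist (x i) (x j))⁻¹ ^ 6 := hb
        _ ≤ |M| * (dist (x i) (x j))⁻¹ ^ 6 := mul_le_mul_of_nonneg_right (le_abs_self M) h0
    have h2 : ∑ i ∈ I, ∑ j ∈ B, |M| * (dist (x i) (x j))⁻¹ ^ 6 =
        |M| * ∑ i ∈ I, ∑ j ∈ B, (dist (x i) (x j))⁻¹ ^ 6 := by
      rw [Finset.mul_sum]
      refine Finset.sum_congr rfl fun i _ => ?_
      rw [Finset.mul_sum]
    have h3 := hflux N x δ hδ hsep I B hdisj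
    have hM0 : 0 ≤ |M| := abs_nonneg M
    rw [h2] at h1
    nlinarith [h1, h3, hM0]
  -- the abstract bookkeeping
  have key := lc_bookkeeping
    (fun i : Fin N => ¬ (∃ (A : EuclideanSpace ℝ (Fin 3) →ₗᵢ[ℝ] EuclideanSpace ℝ (Fin 3)) (t : EuclideanSpace ℝ (Fin 3)) (a : ℝ) (s : ℤ → ℤ) (z : ℤ → ℝ), 47 / 50 ≤ a ∧ a ≤ 1 ∧ IsHaggSeq s ∧ (∀ m : ℤ, 39 / 50 * a ≤ z (m + 1) - z m ∧ z (m + 1) - z m ≤ 17 / 20 * a) ∧ (fun S : Set (EuclideanSpace ℝ (Fin 3)) => (∀ j : Fin N, dist (x j) (x i) ≤ 2 → ∃ p ∈ S, dist (x j + t) p ≤ η) ∧ (∀ p ∈ S, dist p (x i + t) ≤ 2 → ∃ j : Fin N, dist (x j + t) p ≤ η)) {p | ∃ m i j : ℤ, p = A (((i : ℝ) • triangularVec₁ a) + ((j : ℝ) • triangularVec₂ a) + ((haggLabel s m : ℝ) • barlowOffset a) + (z m • layerNormal 1))}))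
    (fun i : Fin N => (1 / 2 : ℝ) * (∑ j ∈ Ω.erase i, lennardJones (dist (x i) (x j))) - (⨅ Q : PeriodicConfiguration 3, Q.energyPerParticle lennardJones))
    τ Ω I B hc hτ hIΩ hBmem
    (fun i hi => hpt i (hIΩ hi) (Finset.mem_filter.1 hi).2)
    hfluxIB
    (fun i _ => hfloor N x δ hδ hsep Ω i)
  have hRHS : (∑ i ∈ Ω, (1 / 2 : ℝ) * (∑ j ∈ Ω.erase i, lennardJones (dist (x i) (x j)))) -
      (Ω.card : ℝ) * (⨅ Q : PeriodicConfiguration 3, Q.energyPerParticle lennardJones) =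
      ∑ i ∈ Ω, ((1 / 2 : ℝ) * (∑ j ∈ Ω.erase i, lennardJones (dist (x i) (x j))) - (⨅ Q : PeriodicConfiguration 3, Q.energyPerParticle lennardJones)) := by
    rw [Finset.sum_sub_distrib, Finset.sum_const, nsmul_eq_mul]
  rw [hRHS]
  have hB0 : (0 : ℝ) ≤ (B.card : ℝ) := Nat.cast_nonneg _
  nlinarith [key, hB0, abs_nonneg M]

end Summit.AtomisticToContinuum.Crystallization.Theorems.PhononSlackNearFieldConvexity
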